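import Mathlib
import Summits.KontsevichZagierPeriods.Zeta5Search.Elimination.DictPencilAxisData
import HarnessLib

/-!
HONEST FRAMING: systematic search; no irrationality claim unless certified — identities and finite bookkeeping only.

# The axis node of the sharpened pencil descent holds (E-L24, part 2 of 2)

fam-elim (class `elim`), gen 25, E-L24.  This file proves the internally minted node
`DictPencilAxis` of `Elimination/PencilDescentSharp.lean` (E-L23b): the dictionary-side pencil
relation at the axis bases `(n;0⁷)`, slot `1`, one instance per level.  It is an identity
among gen-1's rational dictionary values `(Q, P̂, P)` at the three points `a`, `a + dsUp`,
`a + dsUp + slotDown 1`; nothing about sizes, denominators or the irrationality of `ζ(5)`.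
After this file the sharpened descent `explicitPQ_of_terminal_sharp` has the pencil hypothesis
`DictPencilLevelOne` (finitely many instances) and the STAR / cellular nodes left; the class
verdict is unchanged (T1 NO / T2 NO / T4 YES).

## Contents

With `c = bCorner n`, `ax1 = bAx1 n = (n+2;1⁷)`, `ax2 = bAx2 n = (n+2;0,1⁶)` (part 1,
`DictPencilAxisData`: models, (S) unit shift, (DS) diagonal shift) and the dictionary triple
`f = (U, W, V)`:

* (L1) `f(ax2 + e₇) = f(ax1) + (n+1)·f(ax2)` — a polynomial identity of the numerators at the
  common level `n+2` (`axis_L1`);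
* (L2) `n·(3·f(ax1 + e₇) + β·f(ax1) + κ₃·f(ax2)) = (0, 0, −(n+2)⁶/((n+2)!)⁶)` with
  `β = 4n²+3n+3`, `κ₃ = (n+1)⁴+(n+1)²+1` — creative telescoping at level `n+2` with the
  telescoper `X⁶(X+n+1)⁶` (`axis_L2`, needs `n ≥ 1`);
* the gauges `ρ(a+dsUp) = −3n·ρ(a)`, `ρ(a+dsUp+slotDown 1) = (n+1)⁴·ρ(a)` at `a = aCorner n`,
  the coefficients of the node (`pencilBase = −1`, `pencilApex = n+2`, `fanCoeff = (n+1)²`);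
* the row identity `axis_row` (one `linear_combination`) and the node `dictPencilAxis_holds`:
  the hypotheses force `a = aCorner n`, `n ≥ 1`; `Elimination.dict_values` makes the three
  dictionary values `ρ(y)·(casUW, casUV, casVW)(b(y))` (partner-free), and the rows follow from
  (S), (DS), (L1), (L2) and the gauges.
-/

open Finset Polynomial

namespace Summit.KontsevichZagierPeriods.Zeta5Search.Elimination

open Summit.KontsevichZagierPeriods.Zeta5Search.DualSeries
open Summit.KontsevichZagierPeriods.Zeta5Search.WedgeDictionary
open Literature.NumberTheory.Transcendental
open Literature.NumberTheory.Transcendental.BallRivoal (poch_pos)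
open Literature.NumberTheory.Irrationality.BrownZudilin2022 (bOfA)

/-! ## Level-`n+2` bookkeeping for the four points -/

/-- The slot-7 partner of `bAx1 n` lies in the box. -/
theorem inBox_bump_bAx1 (n : ℕ) : InBox (bump (bAx1 n) 6) :=
  inBox_bump6 (bAx1 n) (inBox_bAx1 n) (by rw [bAx1_succ n (by norm_num), bAx1_zero]; omega)

/-- The slot-7 partner of `bAx2 n` lies in the box. -/
theorem inBox_bump_bAx2 (n : ℕ) : InBox (bump (bAx2 n) 6) :=
  inBox_bump6 (bAx2 n) (inBox_bAx2 n)
    (by rw [show (7 : ℕ) = 5 + 2 from rfl, bAx2_succ_succ n (by norm_num), bAx2_zero]; omega)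

/-- Summability bound for `bAx1 n`. -/
theorem hs_bAx1 (n : ℕ) : ∑ j ∈ range 7, bAx1 n (j + 1) ≤ 3 * bAx1 n 0 + 1 := by
  rw [sum_bAx1, bAx1_zero]; omega

/-- Summability bound for `bAx2 n`. -/
theorem hs_bAx2 (n : ℕ) : ∑ j ∈ range 7, bAx2 n (j + 1) ≤ 3 * bAx2 n 0 + 1 := by
  rw [sum_bAx2, bAx2_zero]; omega

/-- Summability bound for the partner of `bAx1 n` (needs `n ≥ 1`). -/
theorem hs_bump_bAx1 (n : ℕ) (hn : 1 ≤ n) :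
    ∑ j ∈ range 7, bump (bAx1 n) 6 (j + 1) ≤ 3 * bump (bAx1 n) 6 0 + 1 := by
  rw [sum_bump_bAx1, bump_zero, bAx1_zero]; omega

/-- Summability bound for the partner of `bAx2 n`. -/
theorem hs_bump_bAx2 (n : ℕ) : ∑ j ∈ range 7, bump (bAx2 n) 6 (j + 1) ≤ 3 * bump (bAx2 n) 6 0 + 1 := by
  rw [sum_bump_bAx2, bump_zero, bAx2_zero]; omega

/-! ## (L1) The partner of `ax2` -/

/-- The numerator identity behind (L1): `numPoly(ax2+e₇) = numPoly(ax1) + (n+1)·numPoly(ax2)`. -/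
theorem axis_L1_rel (n : ℕ) :
    C (1 : ℚ) * numPoly (bump (bAx2 n) 6) + C (-1 : ℚ) * numPoly (bAx1 n) +
        C (-((n : ℚ) + 1)) * numPoly (bAx2 n) =
      (0 : ℚ[X]).comp (X + C 1) * X ^ 6 - 0 * (X + C ((n + 2 : ℕ) : ℚ)) ^ 6 := by
  apply Polynomial.funext
  intro x
  simp only [eval_add, eval_mul, eval_C, eval_zero, zero_comp, zero_mul, sub_zero,
    eval_numPoly_bump_bAx2, eval_numPoly_bAx1, eval_numPoly_bAx2]
  ring

/-- (L1) `f(ax2+e₇) = f(ax1) + (n+1)·f(ax2)` for `f ∈ {U, W, V}`. -/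
theorem axis_L1 (n : ℕ) :
    coeffU (bump (bAx2 n) 6) = coeffU (bAx1 n) + ((n : ℚ) + 1) * coeffU (bAx2 n) ∧
    coeffW (bump (bAx2 n) 6) = coeffW (bAx1 n) + ((n : ℚ) + 1) * coeffW (bAx2 n) ∧
    coeffV (bump (bAx2 n) 6) = coeffV (bAx1 n) + ((n : ℚ) + 1) * coeffV (bAx2 n) := by
  have hg : (0 : ℚ[X]).natDegree + 1 ≤ 6 * (n + 2) := by rw [natDegree_zero]; omega
  have hN0 : (bump (bAx2 n) 6 0).toNat = n + 2 := by rw [bump_zero, bAx2_zero_toNat]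
  obtain ⟨hU, hW⟩ := coeff_rel_of_summable (bump (bAx2 n) 6) (bAx1 n) (bAx2 n) (n + 2) (by omega)
    (inBox_bump_bAx2 n) (inBox_bAx1 n) (inBox_bAx2 n) (hs_bump_bAx2 n) (hs_bAx1 n) (hs_bAx2 n)
    hN0 (bAx1_zero_toNat n) (bAx2_zero_toNat n) 1 (-1) (-((n : ℚ) + 1)) 0 hg (axis_L1_rel n)
  have hrel4 : C (1 : ℚ) * numPoly (bump (bAx2 n) 6) + C (-1 : ℚ) * numPoly (bAx1 n) +
      C (-((n : ℚ) + 1)) * numPoly (bAx2 n) + C (0 : ℚ) * numPoly (bAx2 n) =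
        (0 : ℚ[X]).comp (X + C 1) * X ^ 6 - 0 * (X + C ((n + 2 : ℕ) : ℚ)) ^ 6 := by
    rw [map_zero, zero_mul, add_zero]; exact axis_L1_rel n
  have hV := coeffV_rel_of_summable4 (bump (bAx2 n) 6) (bAx1 n) (bAx2 n) (bAx2 n) (n + 2)
    (by omega) (inBox_bump_bAx2 n) (inBox_bAx1 n) (inBox_bAx2 n) (inBox_bAx2 n) (hs_bump_bAx2 n)
    (hs_bAx1 n) (hs_bAx2 n) (hs_bAx2 n) hN0 (bAx1_zero_toNat n) (bAx2_zero_toNat n)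
    (bAx2_zero_toNat n) 1 (-1) (-((n : ℚ) + 1)) 0 0 hg hrel4
  rw [eval_zero, zero_div] at hV
  refine ⟨?_, ?_, ?_⟩
  · linear_combination hU
  · linear_combination hW
  · linear_combination hV

/-! ## (L2) Creative telescoping at level `n+2` -/

/-- The telescoper `X⁶·(X+n+1)⁶` of (L2). -/
noncomputable def axisTel (n : ℕ) : ℚ[X] := X ^ 6 * (X + C ((n : ℚ) + 1)) ^ 6

/-- `axisTel n` at `x`. -/
theorem eval_axisTel (n : ℕ) (x : ℚ) : (axisTel n).eval x = x ^ 6 * (x + ((n : ℚ) + 1)) ^ 6 := by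
  simp [axisTel]

/-- `deg axisTel ≤ 12`. -/
theorem natDegree_axisTel_le (n : ℕ) : (axisTel n).natDegree ≤ 12 := by
  unfold axisTel
  compute_degree!

/-- The numerator identity behind (L2). -/
theorem axis_L2_rel (n : ℕ) :
    C (-(3 * (n : ℚ))) * numPoly (bump (bAx1 n) 6) +
        C (-((n : ℚ) * (4 * (n : ℚ) ^ 2 + 3 * n + 3))) * numPoly (bAx1 n) +
        C (-((n : ℚ) * (((n : ℚ) + 1) ^ 4 + ((n : ℚ) + 1) ^ 2 + 1))) * numPoly (bAx2 n) =
      (axisTel n).comp (X + C 1) * X ^ 6 - axisTel n * (X + C ((n + 2 : ℕ) : ℚ)) ^ 6 := by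
  apply Polynomial.funext
  intro x
  simp only [eval_add, eval_sub, eval_mul, eval_C, eval_pow, eval_X, eval_comp, eval_axisTel,
    eval_numPoly_bump_bAx1, eval_numPoly_bAx1, eval_numPoly_bAx2]
  push_cast
  ring

/-- (L2) `n·(3·f(ax1+e₇) + β·f(ax1) + κ₃·f(ax2)) = (0, 0, −(n+2)⁶/((1)_{n+2})⁶)` (`n ≥ 1`). -/
theorem axis_L2 (n : ℕ) (hn : 1 ≤ n) :
    (n : ℚ) * (3 * coeffU (bump (bAx1 n) 6) + (4 * (n : ℚ) ^ 2 + 3 * n + 3) * coeffU (bAx1 n) +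
        (((n : ℚ) + 1) ^ 4 + ((n : ℚ) + 1) ^ 2 + 1) * coeffU (bAx2 n)) = 0 ∧
    (n : ℚ) * (3 * coeffW (bump (bAx1 n) 6) + (4 * (n : ℚ) ^ 2 + 3 * n + 3) * coeffW (bAx1 n) +
        (((n : ℚ) + 1) ^ 4 + ((n : ℚ) + 1) ^ 2 + 1) * coeffW (bAx2 n)) = 0 ∧
    (n : ℚ) * (3 * coeffV (bump (bAx1 n) 6) + (4 * (n : ℚ) ^ 2 + 3 * n + 3) * coeffV (bAx1 n) +
        (((n : ℚ) + 1) ^ 4 + ((n : ℚ) + 1) ^ 2 + 1) * coeffV (bAx2 n)) =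
      -(((n : ℚ) + 2) ^ 6 / BallRivoal.poch 1 (n + 2) ^ 6) := by
  have hg : (axisTel n).natDegree + 1 ≤ 6 * (n + 2) := by
    have := natDegree_axisTel_le n; omega
  have hN0 : (bump (bAx1 n) 6 0).toNat = n + 2 := by rw [bump_zero, bAx1_zero_toNat]
  obtain ⟨hU, hW⟩ := coeff_rel_of_summable (bump (bAx1 n) 6) (bAx1 n) (bAx2 n) (n + 2) (by omega)
    (inBox_bump_bAx1 n) (inBox_bAx1 n) (inBox_bAx2 n) (hs_bump_bAx1 n hn) (hs_bAx1 n) (hs_bAx2 n)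
    hN0 (bAx1_zero_toNat n) (bAx2_zero_toNat n) _ _ _ (axisTel n) hg (axis_L2_rel n)
  have hrel4 : C (-(3 * (n : ℚ))) * numPoly (bump (bAx1 n) 6) +
      C (-((n : ℚ) * (4 * (n : ℚ) ^ 2 + 3 * n + 3))) * numPoly (bAx1 n) +
      C (-((n : ℚ) * (((n : ℚ) + 1) ^ 4 + ((n : ℚ) + 1) ^ 2 + 1))) * numPoly (bAx2 n) +
      C (0 : ℚ) * numPoly (bAx2 n) =
        (axisTel n).comp (X + C 1) * X ^ 6 - axisTel n * (X + C ((n + 2 : ℕ) : ℚ)) ^ 6 := by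
    rw [map_zero, zero_mul, add_zero]; exact axis_L2_rel n
  have hV := coeffV_rel_of_summable4 (bump (bAx1 n) 6) (bAx1 n) (bAx2 n) (bAx2 n) (n + 2)
    (by omega) (inBox_bump_bAx1 n) (inBox_bAx1 n) (inBox_bAx2 n) (inBox_bAx2 n)
    (hs_bump_bAx1 n hn) (hs_bAx1 n) (hs_bAx2 n) (hs_bAx2 n) hN0 (bAx1_zero_toNat n)
    (bAx2_zero_toNat n) (bAx2_zero_toNat n) _ _ _ 0 (axisTel n) hg hrel4
  have hev : (axisTel n).eval 1 = ((n : ℚ) + 2) ^ 6 := by rw [eval_axisTel]; ring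
  rw [hev] at hV
  refine ⟨?_, ?_, ?_⟩
  · linear_combination -hU
  · linear_combination -hW
  · linear_combination -hV

/-- The boundary bookkeeping `r + (n+2)·σ = 0` linking (S) and (L2):
`(n+2)/((1)_{n+1})⁶ = (n+2)·(n+2)⁶/((1)_{n+2})⁶`. -/
theorem axis_boundary (n : ℕ) :
    ((n : ℚ) + 2) / BallRivoal.poch 1 (n + 1) ^ 6 +
        ((n : ℚ) + 2) * -(((n : ℚ) + 2) ^ 6 / BallRivoal.poch 1 (n + 2) ^ 6) = 0 := by
  rw [show BallRivoal.poch 1 (n + 2) = BallRivoal.poch 1 (n + 1) * (1 + ((n + 1 : ℕ) : ℚ)) from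
    poch_succ_right 1 (n + 1)]
  have hP := poch_pos (show (0 : ℚ) < 1 by norm_num) (n + 1)
  have hQ : (1 : ℚ) + ((n + 1 : ℕ) : ℚ) ≠ 0 := by positivity
  field_simp
  push_cast
  ring

/-! ## Gauges and coefficients -/

/-- `ρ(aCorner n + dsUp) = −3n·ρ(aCorner n)` (`n ≥ 1`). -/
theorem rhoOf_ax1 (n : ℕ) (hn : 1 ≤ n) :
    rhoOf (aCorner n + dsUp) = -(3 * (n : ℚ)) * rhoOf (aCorner n) := by
  have hf : (((3 * n).factorial : ℕ) : ℚ) = ((3 * n : ℕ) : ℚ) * (((3 * n - 1).factorial : ℕ) : ℚ) := by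
    rw [← Nat.mul_factorial_pred (show 3 * n ≠ 0 by omega)]; push_cast; ring
  rw [rhoOf_aCorner, hf]
  unfold rhoOf
  rw [bOfA_ax1]
  have hd : dOf (bAx1 n) = ((3 * n - 1 : ℕ) : ℤ) := by
    have h3 : 1 ≤ 3 * n := by omega
    rw [dOf, sum_bAx1, bAx1_zero]; push_cast [h3]; ring
  have hT : ((n : ℤ) + 2).toNat - 1 = n + 1 := by omega
  dsimp only
  rw [hd, Int.toNat_natCast, sum_bAx1]
  have hF : (((3 * n - 1).factorial : ℕ) : ℚ) ≠ 0 := by positivity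
  have hn' : (n : ℚ) ≠ 0 := Nat.cast_ne_zero.2 (by omega)
  simp [Epairs, bAx1, hT]
  field_simp

/-- `ρ(aCorner n + dsUp + slotDown 1) = (n+1)⁴·ρ(aCorner n)`. -/
theorem rhoOf_ax2 (n : ℕ) :
    rhoOf (aCorner n + dsUp + slotDown 1) = ((n : ℚ) + 1) ^ 4 * rhoOf (aCorner n) := by
  rw [rhoOf_aCorner]
  unfold rhoOf
  rw [bOfA_ax2]
  have hd : dOf (bAx2 n) = ((3 * n : ℕ) : ℤ) := by
    rw [dOf, sum_bAx2, bAx2_zero]; push_cast; ring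
  have hT : ((n : ℤ) + 2).toNat - 1 = n + 1 := by omega
  dsimp only
  rw [hd, Int.toNat_natCast, sum_bAx2]
  simp [Epairs, bAx2, hT, Nat.factorial_succ]
  ring

/-- The pencil base coefficient at the corner: `−(c₂+1)(c₃+1) = −1`. -/
theorem pencilBase_bCorner (n : ℕ) : pencilBase (bCorner n) = -1 := by
  simp [pencilBase, bCorner]

/-- The pencil apex coefficient of slot `1` at the corner: `(c₁+1)(c₀+2−c₁) = n+2`. -/
theorem pencilApex_bCorner_one (n : ℕ) : pencilApex (bCorner n) 1 = (n : ℤ) + 2 := by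
  simp [pencilApex, bCorner]

/-- The fan coefficient of slot `1` at `ax1 = (n+2;1⁷)`: `(n+1)²`. -/
theorem fanCoeff_bAx1_one (n : ℕ) : fanCoeff (bAx1 n) 1 = ((n : ℤ) + 1) ^ 2 := by
  simp [fanCoeff, chiOf, nonEdgePartners, bAx1]
  ring

/-! ## The row identity (pure algebra) -/

/-- The algebra of one row of the axis node.  Variables: `x₀,y₀ / xh₀,yh₀` two coordinates of
`f` at `c` / `c+e₇`; `x₁,… ` at `ax1` / `ax1+e₇`; `x₂,…` at `ax2` / `ax2+e₇`; `εx, εy ∈ {0,1}`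
mark the `V` coordinate (the only one with boundary terms `r`, `σ`). -/
theorem axis_row {n r σ x₀ y₀ xh₀ yh₀ x₁ y₁ xh₁ yh₁ x₂ y₂ xh₂ yh₂ εx εy : ℚ}
    (hx₁ : x₁ = xh₀ - (n + 1) * x₀) (hy₁ : y₁ = yh₀ - (n + 1) * y₀)
    (hx₂ : x₂ = x₀ + εx * r) (hy₂ : y₂ = y₀ + εy * r)
    (hxh₂ : xh₂ = x₁ + (n + 1) * x₂) (hyh₂ : yh₂ = y₁ + (n + 1) * y₂)
    (hLx : n * (3 * xh₁ + (4 * n ^ 2 + 3 * n + 3) * x₁ + ((n + 1) ^ 4 + (n + 1) ^ 2 + 1) * x₂) =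
      εx * σ)
    (hLy : n * (3 * yh₁ + (4 * n ^ 2 + 3 * n + 3) * y₁ + ((n + 1) ^ 4 + (n + 1) ^ 2 + 1) * y₂) =
      εy * σ)
    (hrσ : r + (n + 2) * σ = 0) :
    -1 * (x₀ * yh₀ - xh₀ * y₀) + (n + 2) * (-(3 * n) * (x₁ * yh₁ - xh₁ * y₁)) +
        (n + 1) ^ 2 * ((n + 1) ^ 4 * (x₂ * yh₂ - xh₂ * y₂)) = 0 := by
  subst hxh₂ hyh₂ hx₂ hy₂ hx₁ hy₁
  linear_combination (n + 2) * (yh₀ - (n + 1) * y₀) * hLx - (n + 2) * (xh₀ - (n + 1) * x₀) * hLy -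
    (εy * (xh₀ - (n + 1) * x₀) - εx * (yh₀ - (n + 1) * y₀)) * hrσ

/-! ## The three rows at the models -/

/-- The three rows of the axis node, stated over the models `bCorner n`, `bAx1 n`, `bAx2 n`. -/
theorem axis_rows (n : ℕ) (hn : 1 ≤ n) :
    (-1 : ℚ) * (rhoOf (aCorner n) * casUW (bCorner n)) +
        ((n : ℚ) + 2) * (rhoOf (aCorner n + dsUp) * casUW (bAx1 n)) +
        ((n : ℚ) + 1) ^ 2 * (rhoOf (aCorner n + dsUp + slotDown 1) * casUW (bAx2 n)) = 0 ∧
    (-1 : ℚ) * (rhoOf (aCorner n) * casUV (bCorner n)) +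
        ((n : ℚ) + 2) * (rhoOf (aCorner n + dsUp) * casUV (bAx1 n)) +
        ((n : ℚ) + 1) ^ 2 * (rhoOf (aCorner n + dsUp + slotDown 1) * casUV (bAx2 n)) = 0 ∧
    (-1 : ℚ) * (rhoOf (aCorner n) * casVW (bCorner n)) +
        ((n : ℚ) + 2) * (rhoOf (aCorner n + dsUp) * casVW (bAx1 n)) +
        ((n : ℚ) + 1) ^ 2 * (rhoOf (aCorner n + dsUp + slotDown 1) * casVW (bAx2 n)) = 0 := by
  rw [rhoOf_ax1 n hn, rhoOf_ax2 n]
  obtain ⟨SU, SW, SV⟩ := axis_shift n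
  obtain ⟨DU, DW, DV⟩ := axis_ds n
  obtain ⟨L1U, L1W, L1V⟩ := axis_L1 n
  obtain ⟨L2U, L2W, L2V⟩ := axis_L2 n hn
  have hr := axis_boundary n
  have SU' : coeffU (bAx2 n) = coeffU (bCorner n) + 0 * (((n : ℚ) + 2) / BallRivoal.poch 1 (n + 1) ^ 6) := by
    rw [zero_mul, add_zero]; exact SU
  have SW' : coeffW (bAx2 n) = coeffW (bCorner n) + 0 * (((n : ℚ) + 2) / BallRivoal.poch 1 (n + 1) ^ 6) := by
    rw [zero_mul, add_zero]; exact SW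
  have SV' : coeffV (bAx2 n) = coeffV (bCorner n) + 1 * (((n : ℚ) + 2) / BallRivoal.poch 1 (n + 1) ^ 6) := by
    rw [one_mul]; exact SV
  have L2U' := L2U.trans (zero_mul (-(((n : ℚ) + 2) ^ 6 / BallRivoal.poch 1 (n + 2) ^ 6))).symm
  have L2W' := L2W.trans (zero_mul (-(((n : ℚ) + 2) ^ 6 / BallRivoal.poch 1 (n + 2) ^ 6))).symm
  have L2V' := L2V.trans (one_mul (-(((n : ℚ) + 2) ^ 6 / BallRivoal.poch 1 (n + 2) ^ 6))).symm
  have RUW := axis_row DU DW SU' SW' L1U L1W L2U' L2W' hr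
  have RUV := axis_row DU DV SU' SV' L1U L1V L2U' L2V' hr
  have RVW := axis_row DV DW SV' SW' L1V L1W L2V' L2W' hr
  unfold casUW casUV casVW
  exact ⟨by linear_combination rhoOf (aCorner n) * RUW, by linear_combination rhoOf (aCorner n) * RUV,
    by linear_combination rhoOf (aCorner n) * RVW⟩

/-! ## The node -/

/-- Zero slots and `b₀ = n` force `a = aCorner n` (inverting Brown–Zudilin's `b(a)`). -/
theorem eq_aCorner_of_slots {a : Fin 8 → ℤ} (h : ∀ m ∈ Icc 1 7, bOfA a m = 0) {n : ℕ}
    (h0 : bOfA a 0 = n) : a = aCorner n := by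
  have e1 := h 1 (by simp); have e2 := h 2 (by simp); have e3 := h 3 (by simp); have e4 := h 4 (by simp)
  have e5 := h 5 (by simp); have e6 := h 6 (by simp); have e7 := h 7 (by simp)
  simp only [bOfA] at h0 e1 e2 e3 e4 e5 e6 e7
  funext i
  fin_cases i <;> simp [aCorner] <;> omega

/-- **E-L24.  The axis node `DictPencilAxis` of the sharpened pencil descent holds.** -/
theorem dictPencilAxis_holds : DictPencilAxis := by
  intro a j₀ j₁ j₂ hz H₀ H₁ H₂
  have hpart := H₀.2.2.2.2
  have hb1 : bOfA a 1 = 0 := hz 1 (by simp)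
  have hj₀ : bOfA a j₀ = 0 := hz j₀ H₀.1
  obtain ⟨n, hn0⟩ : ∃ n : ℕ, bOfA a 0 = n := ⟨(bOfA a 0).toNat, by omega⟩
  have hn : 1 ≤ n := by omega
  have ha : a = aCorner n := eq_aCorner_of_slots hz hn0
  subst ha
  obtain ⟨q0, p0, r0⟩ := dict_values H₀
  obtain ⟨q1, p1, r1⟩ := dict_values H₁
  obtain ⟨q2, p2, r2⟩ := dict_values H₂
  obtain ⟨RUW, RUV, RVW⟩ := axis_rows n hn
  rw [bOfA_aCorner] at q0 p0 r0
  rw [bOfA_ax1] at q1 p1 r1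
  rw [bOfA_ax2] at q2 p2 r2
  unfold DictThreeTerm
  rw [bOfA_aCorner, bOfA_ax1, pencilBase_bCorner, pencilApex_bCorner_one, fanCoeff_bAx1_one, q0, q1, q2,
    p0, p1, p2, r0, r1, r2]
  push_cast
  exact ⟨RUW, RUV, RVW⟩

end Summit.KontsevichZagierPeriods.Zeta5Search.Elimination
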